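import Summits.AnomalousDissipation.AnomalousDissipation.Theorems.SolenoidalFractalHomogenisationLagrangianStepCellLawVSlowGraphPeriodic
import Summits.AnomalousDissipation.AnomalousDissipation.Theorems.SolenoidalFractalHomogenisationLagrangianStepCellLawVSlowGraphReduction
import Literature.Analysis.ODE.LinearPeriodicAveraging
import Mathlib.Analysis.Calculus.Deriv.Shift
import HarnessLib

/-!
# K1L `LagrangianRenormalisationStep(Design)` (K1L_D, stmt-AnomalousDissipation-27980; aside 24912), stub `stub_cellLawV0_IS`
# — the ABSTRACT SLOW-GRAPH LEVER, part 6: the periodic graph on a whole window and SLOW-AMPLITUDE TRACKING by the averaged generator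
# (helper; `--supports stmt-AnomalousDissipation-27980`; word-independent)

Summits-side helper file of route `SolenoidalFractalHomogenisation` (planner ad-ideate-p5's STUB-PLAN for `stub_cellLawV` §1 (V) steps V1/V2/V3/V5/V6,
tenure D24-1; crux idea `chang-slow-graph`), on top of parts 1–5 (`…SlowGraphBall` G1, `…SlowGraphReduction` G2/G3, `…SlowGraphExistence` G0,
`…SlowGraphContraction` G4, `…SlowGraphPeriodic` G0′/G5) and of ad-lit's first-order averaging lemma `Literature/Analysis/ODE/LinearPeriodicAveraging`
(`PeriodicAveraging.norm_sub_exp_apply_le`, Sanders–Verhulst–Murdock Thm 2.8.1/5.5.1 with Besjes' lemma).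
* §13 `riccatiGraph_periodic_on` (G5′) — for coefficients `P`-periodic and continuous on `[0, T]` (`0 < P ≤ T`) under G1's hypotheses there is a Riccati
  graph `M` on `[0, T]` in the ball with `M (t + P) = M t` (G5's fixed point continued by G0′ and uniqueness G4).
* §14 `slow_tracking` (G6) — **THE FINITE-DIMENSIONAL CORE OF CLAUSE (V).**  For the block system `ẋ = A₁₁x + A₁₂z`, `ż = A₂₁x + A₂₂z` with
  `P`-periodic continuous coefficients on `[0, T]`, G1's constants (`γ, δ, s₀`, `r = 2δ/(γ−s₀)`, `κ = (γ−s₀)(1−r²)`), a DISSIPATIVE slow block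
  `⟪A₁₁v, v⟫ ≤ −a₀‖v‖²` with `a₀ > δr`, and the EMPTY-GRAPH datum `z(0) = 0` (the single-mode datum of (V) has no fast content), the slow component tracks the
  flow of the AVERAGED REDUCED GENERATOR `Ḡ := −(1/P)∫₀ᴾ (A₁₁ + A₁₂ M)` on the periodic graph `M`:
  `‖x t − e^{−tḠ} x 0‖ ≤ ‖x 0‖·(η (min(t, 1/r_lo) + P) + L_g P (1 + (2G_n + L_g)/r_lo))`, `η = δr/(κP)` (the transient of the graph, G4),
  `L_g = 2(s₀ + δr)`, `G_n = s₀ + δr`, `r_lo = a₀ − δr` — i.e. DECAY-RELATIVE error `O(1/(κP))` plus the burst `O((s₀ + δr)·P)`, exactly the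
  shape `C·(e·min(1, r̄t) + r̄P)` of `SlowVectorClauseNoExF` at the Galerkin level (G0 + G2: `z = Lx`, `ẋ = (A₁₁ + A₁₂L)x`; G5′: `M`; G4: `‖L − M‖ ≤ re^{−κt}`;
  energy: `‖x t‖ ≤ ‖x 0‖`; Besjes/SVM averaging with window means `‖∫_{nP}^{(n+1)P} A₁₂(L − M)‖ ≤ δr/κ`).
No named facts, no new definitions, no sorry.  What is NOT here: the PDE side (the Galerkin block form of the cell system with its constants, V0, and the
identification of `Ḡ` with the effective tensor of D24-1's `Φν`, D1/V3) — this file is the abstract ODE statement they plug into.  Infrastructure for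
route-1's rung leaf F-D1.A0 (frontier FORMAL rung); NOT a proof of the stub, of the crux, of Onsager's conjecture or of anomalous dissipation.  Prover seat
`ad-k1l-cellLawV-w1` g3, 2026-08-28.
-/

set_option linter.dupNamespace false

noncomputable section

namespace Summit.AnomalousDissipation.AnomalousDissipation.Theorems.SolenoidalFractalHomogenisation.LagrangianStep

namespace SlowGraph

open Set Filter Topology Metric MeasureTheory intervalIntegral
open scoped InnerProductSpace NNReal

/-! ## §13 G5′ — the periodic graph on a whole window `[0, T]` -/

section PeriodicWindow

/-- **G5′ — THE PERIODIC RICCATI GRAPH ON `[0, T]`.**  For coefficients continuous on `[0, T]` and `P`-periodic there (`A (t + P) = A t` whenever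
`0 ≤ t`, `t + P ≤ T`; `0 < P ≤ T`) satisfying G1's hypotheses, there is a solution `M` of `Ṁ = A₂₁ + A₂₂M − MA₁₁ − MA₁₂M` on `[0, T)`, continuous on
`[0, T]`, in the ball `‖M t‖ ≤ r = 2δ/(γ−s₀)`, with `M (t + P) = M t` (G5's fixed point of the period map, continued to `[0, T]` by G0′; periodicity by
uniqueness G4 applied to the shifted graph). [cite: KokotovicBensoussanBlankenship1987, §2 eq. (2.29), Thm 2.3] -/
theorem riccatiGraph_periodic_on (E F : Type) [NormedAddCommGroup E] [InnerProductSpace ℝ E] [FiniteDimensional ℝ E]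
    [NormedAddCommGroup F] [InnerProductSpace ℝ F] [FiniteDimensional ℝ F]
    (A₁₁ : ℝ → E →L[ℝ] E) (A₁₂ : ℝ → F →L[ℝ] E) (A₂₁ : ℝ → E →L[ℝ] F) (A₂₂ : ℝ → F →L[ℝ] F) (γ δ s₀ P T : ℝ)
    (hδ : 0 ≤ δ) (hs₀ : 0 ≤ s₀) (hsγ : s₀ < γ) (h8 : 8 * δ ^ 2 ≤ (γ - s₀) ^ 2) (hP : 0 < P) (hPT : P ≤ T)
    (hA₂₂ : ∀ t ∈ Icc 0 T, ∀ z : F, ⟪A₂₂ t z, z⟫_ℝ ≤ -γ * ‖z‖ ^ 2)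
    (h₁₁ : ∀ t ∈ Icc 0 T, ‖A₁₁ t‖ ≤ s₀) (h₁₂ : ∀ t ∈ Icc 0 T, ‖A₁₂ t‖ ≤ δ) (h₂₁ : ∀ t ∈ Icc 0 T, ‖A₂₁ t‖ ≤ δ)
    (hc₁₁ : ContinuousOn A₁₁ (Icc 0 T)) (hc₁₂ : ContinuousOn A₁₂ (Icc 0 T)) (hc₂₁ : ContinuousOn A₂₁ (Icc 0 T))
    (hc₂₂ : ContinuousOn A₂₂ (Icc 0 T))
    (hp₁₁ : ∀ t, 0 ≤ t → t + P ≤ T → A₁₁ (t + P) = A₁₁ t) (hp₁₂ : ∀ t, 0 ≤ t → t + P ≤ T → A₁₂ (t + P) = A₁₂ t)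
    (hp₂₁ : ∀ t, 0 ≤ t → t + P ≤ T → A₂₁ (t + P) = A₂₁ t) (hp₂₂ : ∀ t, 0 ≤ t → t + P ≤ T → A₂₂ (t + P) = A₂₂ t) :
    ∃ M : ℝ → E →L[ℝ] F, ContinuousOn M (Icc 0 T) ∧
      (∀ t ∈ Ico 0 T, HasDerivAt M (A₂₁ t + (A₂₂ t).comp (M t) - (M t).comp (A₁₁ t) - ((M t).comp (A₁₂ t)).comp (M t)) t) ∧
      (∀ t ∈ Icc 0 T, ‖M t‖ ≤ 2 * δ / (γ - s₀)) ∧ ∀ t, 0 ≤ t → t + P ≤ T → M (t + P) = M t := by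
  have hγ : 0 < γ := lt_of_le_of_lt hs₀ hsγ
  have hT : 0 ≤ T := hP.le.trans hPT
  have hsub : Icc 0 P ⊆ Icc 0 T := Icc_subset_Icc le_rfl hPT
  -- G5 on `[0, P]`
  obtain ⟨L₅, h5P, h5c, h5d, h5b⟩ := riccatiGraph_periodic_exists E F A₁₁ A₁₂ A₂₁ A₂₂ γ δ s₀ P hδ hs₀ hsγ h8 hP
    (fun t ht => hA₂₂ t (hsub ht)) (fun t ht => h₁₁ t (hsub ht)) (fun t ht => h₁₂ t (hsub ht)) (fun t ht => h₂₁ t (hsub ht))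
    (hc₁₁.mono hsub) (hc₁₂.mono hsub) (hc₂₁.mono hsub) (hc₂₂.mono hsub)
  have hLstar : ‖L₅ 0‖ ≤ 2 * δ / (γ - s₀) := h5b 0 ⟨le_rfl, hP.le⟩
  -- G0′ from `L₅ 0` on `[0, T]`
  obtain ⟨M, hM0, hMc, hMd, hMb⟩ := riccatiGraph_exists_of_norm_le E F A₁₁ A₁₂ A₂₁ A₂₂ γ δ s₀ T hδ hs₀ hsγ h8 hT hA₂₂ h₁₁ h₁₂ h₂₁
    hc₁₁ hc₁₂ hc₂₁ hc₂₂ (L₅ 0) hLstar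
  -- `M = L₅` on `[0, P]`, hence `M P = M 0`
  have hMP : M P = M 0 := by
    have hu := riccati_unique (T := P) hγ hδ hs₀ hsγ h8 hP.le (fun t ht => hA₂₂ t (hsub ht)) (fun t ht => h₁₁ t (hsub ht))
      (fun t ht => h₁₂ t (hsub ht)) (fun t ht => h₂₁ t (hsub ht))
      (fun t ht => hMd t ⟨ht.1, lt_of_lt_of_le ht.2 hPT⟩) h5d (hMc.mono hsub) h5c (by rw [hM0]; exact hLstar) hM0 P ⟨hP.le, le_rfl⟩
    rw [hu, h5P, hM0]
  refine ⟨M, hMc, hMd, hMb, fun t ht htP => ?_⟩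
  -- the shifted graph `s ↦ M (s + P)` solves the same equation on `[0, T − P]` from `M P = M 0`
  have hTP : 0 ≤ T - P := by linarith
  have hsub' : Icc 0 (T - P) ⊆ Icc 0 T := Icc_subset_Icc le_rfl (by linarith)
  have hshift_d : ∀ s ∈ Ico 0 (T - P), HasDerivAt (fun s => M (s + P))
      (A₂₁ s + (A₂₂ s).comp (M (s + P)) - (M (s + P)).comp (A₁₁ s) - ((M (s + P)).comp (A₁₂ s)).comp (M (s + P))) s := by
    intro s hs
    have hsP : s + P ∈ Ico 0 T := ⟨by linarith [hs.1], by linarith [hs.2]⟩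
    have h := HasDerivAt.comp_add_const s P (hMd (s + P) hsP)
    rw [hp₁₁ s hs.1 (by linarith [hs.2]), hp₁₂ s hs.1 (by linarith [hs.2]), hp₂₁ s hs.1 (by linarith [hs.2]),
      hp₂₂ s hs.1 (by linarith [hs.2])] at h
    exact h
  have hshift_c : ContinuousOn (fun s => M (s + P)) (Icc 0 (T - P)) := by
    refine hMc.comp (continuous_add_const P).continuousOn fun s hs => ?_
    exact ⟨by linarith [hs.1], by linarith [hs.2]⟩
  have hu := riccati_unique (L := fun s => M (s + P)) (L' := M) (T := T - P) hγ hδ hs₀ hsγ h8 hTP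
    (fun t ht => hA₂₂ t (hsub' ht)) (fun t ht => h₁₁ t (hsub' ht)) (fun t ht => h₁₂ t (hsub' ht)) (fun t ht => h₂₁ t (hsub' ht))
    hshift_d (fun t ht => hMd t ⟨ht.1, by linarith [ht.2]⟩) hshift_c (hMc.mono hsub')
    (by rw [zero_add]; exact hMb P ⟨hP.le, hPT⟩) (by rw [zero_add]; exact hMP) t ⟨ht, by linarith⟩
  exact hu

end PeriodicWindow

/-! ## §14 G6 — slow-amplitude tracking by the averaged reduced generator (the finite-dimensional core of clause (V)) -/

section Tracking

/-- `∫ₐᵇ e^{−κs} ds ≤ 1/κ` for `0 ≤ a`, `κ > 0` (any `b`). [folklore] -/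
theorem integral_exp_neg_mul_le {κ a b : ℝ} (hκ : 0 < κ) (ha : 0 ≤ a) :
    ∫ s in a..b, Real.exp (-(κ * s)) ≤ 1 / κ := by
  have hderiv : ∀ x ∈ uIcc a b, HasDerivAt (fun s => -(1 / κ) * Real.exp (-(κ * s))) (Real.exp (-(κ * x))) x := by
    intro x _
    have h1 : HasDerivAt (fun s => -(κ * s)) (-(κ * 1)) x := ((hasDerivAt_id x).const_mul κ).neg
    have h3 := h1.exp.const_mul (-(1 / κ))
    refine h3.congr_deriv ?_
    rw [mul_one]; field_simp
  rw [intervalIntegral.integral_eq_sub_of_hasDerivAt hderiv ((Real.continuous_exp.comp (continuous_const.mul continuous_id).neg).intervalIntegrable _ _)]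
  have h1 : 0 < Real.exp (-(κ * b)) := Real.exp_pos _
  have h2 : Real.exp (-(κ * a)) ≤ 1 := Real.exp_le_one_iff.mpr (by nlinarith)
  have e : -(1 / κ) * Real.exp (-(κ * b)) - -(1 / κ) * Real.exp (-(κ * a)) = (Real.exp (-(κ * a)) - Real.exp (-(κ * b))) / κ := by
    field_simp; ring
  rw [e, div_le_div_iff_of_pos_right hκ]
  linarith

/-- Shifts by multiples of the period: if `G (s + P) = G s` whenever `0 ≤ s`, `s + P ≤ T`, then `G (s + n P) = G s` for `0 ≤ s`, `s + n P ≤ T`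
(`P ≥ 0`). [folklore] -/
theorem periodic_shift_nat {W : Type*} {G : ℝ → W} {P T : ℝ} (hP : 0 ≤ P) (hG : ∀ s, 0 ≤ s → s + P ≤ T → G (s + P) = G s) :
    ∀ (n : ℕ) (s : ℝ), 0 ≤ s → s + n * P ≤ T → G (s + n * P) = G s := by
  intro n
  induction n with
  | zero => intro s _ _; simp
  | succ k ih =>
    intro s hs hsT
    have hk : s + k * P ≤ T := by push_cast at hsT; nlinarith
    have e : s + (↑(k + 1) : ℝ) * P = (s + k * P) + P := by push_cast; ring
    rw [e, hG (s + k * P) (by positivity) (by push_cast at hsT; linarith), ih s hs hk]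

/-- **G6 — SLOW-AMPLITUDE TRACKING BY THE AVERAGED REDUCED GENERATOR (finite-dimensional core of clause (V) = `SlowVectorClauseNoExF`).**
Block system `ẋ = A₁₁x + A₁₂z`, `ż = A₂₁x + A₂₂z` on `[0, T)` with coefficients continuous on `[0, T]` and `P`-periodic there (`0 < P ≤ T`), G1's
hypotheses (`γ`-dissipative fast block, `‖A₁₁‖ ≤ s₀ < γ`, couplings `≤ δ`, `8δ² ≤ (γ−s₀)²`; `r = 2δ/(γ−s₀)`, `κ = (γ−s₀)(1−r²)`), a DISSIPATIVE slow block
`⟪A₁₁v, v⟫ ≤ −a₀‖v‖²` with `a₀ > δr`, a periodic Riccati graph `M` in the ball (G5′), and the EMPTY-GRAPH datum `z 0 = 0`.  Then, with the AVERAGED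
REDUCED GENERATOR `Ḡ = −(1/P)∫₀ᴾ (A₁₁ s + A₁₂ s ∘ M s) ds`, for every `t ∈ [0, T)`:
`‖x t − e^{−tḠ} x 0‖ ≤ ‖x 0‖·(η (min(t, 1/r_lo) + P) + L_g P (1 + (2G_n + L_g)/r_lo))`, `η = δr/(κP)`, `L_g = 2(s₀ + δr)`, `G_n = s₀ + δr`,
`r_lo = a₀ − δr`.  Proof: G0 + G2 (`z = Lx`, `ẋ = (A₁₁ + A₁₂L)x`), G1 (`‖L‖, ‖M‖ ≤ r`), G4 (`‖L s − M s‖ ≤ r e^{−κs}` ⇒ window means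
`‖∫_{nP}^{(n+1)P} A₁₂(L − M)‖ ≤ δr/κ`, the periodic part averaging to `−PḠ` exactly), energy (`‖x s‖ ≤ ‖x 0‖`), and ad-lit's Besjes/SVM averaging lemma
`PeriodicAveraging.norm_sub_exp_apply_le`. [cite: SandersVerhulstMurdock2007, Thm 2.8.1 / Thm 5.5.1 (linear case)] -/
theorem slow_tracking (E F : Type) [NormedAddCommGroup E] [InnerProductSpace ℝ E] [FiniteDimensional ℝ E]
    [NormedAddCommGroup F] [InnerProductSpace ℝ F] [FiniteDimensional ℝ F]
    (A₁₁ : ℝ → E →L[ℝ] E) (A₁₂ : ℝ → F →L[ℝ] E) (A₂₁ : ℝ → E →L[ℝ] F) (A₂₂ : ℝ → F →L[ℝ] F)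
    (M : ℝ → E →L[ℝ] F) (x : ℝ → E) (z : ℝ → F) (γ δ s₀ a₀ P T : ℝ)
    (hδ : 0 ≤ δ) (hs₀ : 0 ≤ s₀) (hsγ : s₀ < γ) (h8 : 8 * δ ^ 2 ≤ (γ - s₀) ^ 2) (hP : 0 < P) (hPT : P ≤ T)
    (hA₂₂ : ∀ t ∈ Icc 0 T, ∀ z : F, ⟪A₂₂ t z, z⟫_ℝ ≤ -γ * ‖z‖ ^ 2)
    (h₁₁ : ∀ t ∈ Icc 0 T, ‖A₁₁ t‖ ≤ s₀) (h₁₂ : ∀ t ∈ Icc 0 T, ‖A₁₂ t‖ ≤ δ) (h₂₁ : ∀ t ∈ Icc 0 T, ‖A₂₁ t‖ ≤ δ)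
    (hc₁₁ : ContinuousOn A₁₁ (Icc 0 T)) (hc₁₂ : ContinuousOn A₁₂ (Icc 0 T)) (hc₂₁ : ContinuousOn A₂₁ (Icc 0 T))
    (hc₂₂ : ContinuousOn A₂₂ (Icc 0 T))
    (hp₁₁ : ∀ t, 0 ≤ t → t + P ≤ T → A₁₁ (t + P) = A₁₁ t) (hp₁₂ : ∀ t, 0 ≤ t → t + P ≤ T → A₁₂ (t + P) = A₁₂ t)
    (ha₀ : ∀ t ∈ Icc 0 T, ∀ v : E, ⟪A₁₁ t v, v⟫_ℝ ≤ -a₀ * ‖v‖ ^ 2) (hgap : δ * (2 * δ / (γ - s₀)) < a₀)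
    (hMc : ContinuousOn M (Icc 0 T))
    (hMd : ∀ t ∈ Ico 0 T, HasDerivAt M (A₂₁ t + (A₂₂ t).comp (M t) - (M t).comp (A₁₁ t) - ((M t).comp (A₁₂ t)).comp (M t)) t)
    (hM0 : ‖M 0‖ ≤ 2 * δ / (γ - s₀)) (hMp : ∀ t, 0 ≤ t → t + P ≤ T → M (t + P) = M t)
    (hx : ∀ t ∈ Ico 0 T, HasDerivAt x (A₁₁ t (x t) + A₁₂ t (z t)) t)
    (hz : ∀ t ∈ Ico 0 T, HasDerivAt z (A₂₁ t (x t) + A₂₂ t (z t)) t)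
    (hxc : ContinuousOn x (Icc 0 T)) (hzc : ContinuousOn z (Icc 0 T)) (hz0 : z 0 = 0) :
    ∀ t ∈ Ico 0 T, ‖x t - NormedSpace.exp (-(t • (-(1 / P) • ∫ s in (0:ℝ)..P, (A₁₁ s + (A₁₂ s).comp (M s))))) (x 0)‖ ≤
      ‖x 0‖ * ((δ * (2 * δ / (γ - s₀)) / (((γ - s₀) * (1 - (2 * δ / (γ - s₀)) ^ 2)) * P)) *
          (min t (1 / (a₀ - δ * (2 * δ / (γ - s₀)))) + P) +
        (2 * (s₀ + δ * (2 * δ / (γ - s₀)))) * P *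
          (1 + (2 * (s₀ + δ * (2 * δ / (γ - s₀))) + 2 * (s₀ + δ * (2 * δ / (γ - s₀)))) / (a₀ - δ * (2 * δ / (γ - s₀))))) := by
  intro t ht
  have hγ : 0 < γ := lt_of_le_of_lt hs₀ hsγ
  have hgs : 0 < γ - s₀ := by linarith
  have hT : 0 ≤ T := hP.le.trans hPT
  set r := 2 * δ / (γ - s₀) with hr
  have hr0 : 0 ≤ r := by positivity
  have hr2 : r ^ 2 ≤ 1 / 2 := by
    rw [hr, div_pow, div_le_div_iff₀ (by positivity) (by norm_num)]
    nlinarith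
  set κ := (γ - s₀) * (1 - r ^ 2) with hκ
  have hκpos : 0 < κ := mul_pos hgs (by linarith)
  have hrlo : 0 < a₀ - δ * r := by linarith
  -- G0: the graph from the empty graph; G1: the ball for `L` and `M`
  obtain ⟨L, hL0, hLc, hLd, hLb⟩ := riccatiGraph_exists E F A₁₁ A₁₂ A₂₁ A₂₂ γ δ s₀ T hδ hs₀ hsγ h8 hT hA₂₂ h₁₁ h₁₂ h₂₁ hc₁₁ hc₁₂ hc₂₁ hc₂₂
  have hMb := riccatiInvariantBall E F A₁₁ A₁₂ A₂₁ A₂₂ M γ δ s₀ T hγ hδ hs₀ hsγ h8 hT hA₂₂ h₁₁ h₁₂ h₂₁ hMd hMc hM0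
  -- G2: exact reduction (needs a uniform bound `B`)
  obtain ⟨C₂₂, hC₂₂⟩ := isCompact_Icc.exists_bound_of_continuousOn hc₂₂
  set B := max C₂₂ (max δ r) with hB
  have hBall : ∀ s ∈ Icc 0 T, ‖A₂₂ s‖ ≤ B ∧ ‖A₁₂ s‖ ≤ B ∧ ‖L s‖ ≤ B := fun s hs =>
    ⟨(hC₂₂ s hs).trans (le_max_left _ _), (h₁₂ s hs).trans ((le_max_left _ _).trans (le_max_right _ _)),
      (hLb s hs).trans ((le_max_right _ _).trans (le_max_right _ _))⟩
  have hLx0 : z 0 = L 0 (x 0) := by rw [hz0, hL0]; rfl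
  obtain ⟨_, hxd⟩ := graphReduction E F A₁₁ A₁₂ A₂₁ A₂₂ L x z T B hT hBall hLd hx hz hLc hxc hzc hLx0
  -- G4: the transient `‖L s − M s‖ ≤ r e^{−κ s}`
  have hLM : ∀ s ∈ Icc 0 T, ‖L s - M s‖ ≤ r * Real.exp (-(κ * s)) := by
    intro s hs
    have h := riccati_contraction E F A₁₁ A₁₂ A₂₁ A₂₂ L M γ δ s₀ T hγ hδ hs₀ hsγ h8 hT hA₂₂ h₁₁ h₁₂ h₂₁ hLd hMd hLc hMc
      (by rw [hL0, norm_zero]; exact hr0) hM0 s hs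
    rw [hL0, zero_sub, norm_neg] at h
    calc ‖L s - M s‖ ≤ Real.exp (-((γ - s₀) * (1 - (2 * δ / (γ - s₀)) ^ 2)) * s) * ‖M 0‖ := h
      _ ≤ Real.exp (-((γ - s₀) * (1 - (2 * δ / (γ - s₀)) ^ 2)) * s) * r := mul_le_mul_of_nonneg_left hM0 (Real.exp_pos _).le
      _ = r * Real.exp (-(κ * s)) := by rw [hκ, hr, mul_comm, neg_mul]
  -- the periodic integrand `F s = A₁₁ s + A₁₂ s ∘ M s`, the averaged generator `Ḡ`
  set Fm : ℝ → E →L[ℝ] E := fun s => A₁₁ s + (A₁₂ s).comp (M s) with hFm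
  have hFmc : ContinuousOn Fm (Icc 0 T) := hc₁₁.add (hc₁₂.clm_comp hMc)
  have hFmi : ∀ a b, 0 ≤ a → a ≤ b → b ≤ T → IntervalIntegrable Fm volume a b := fun a b ha hab hb =>
    (hFmc.mono (Icc_subset_Icc ha hb)).intervalIntegrable_of_Icc hab
  have hFmn : ∀ s ∈ Icc 0 T, ‖Fm s‖ ≤ s₀ + δ * r := fun s hs =>
    (norm_add_le _ _).trans (add_le_add (h₁₁ s hs) ((ContinuousLinearMap.opNorm_comp_le _ _).trans
      (mul_le_mul (h₁₂ s hs) (hMb s hs) (norm_nonneg _) hδ)))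
  have hFmp : ∀ s, 0 ≤ s → s + P ≤ T → Fm (s + P) = Fm s := fun s hs hsP => by
    simp only [hFm, hp₁₁ s hs hsP, hp₁₂ s hs hsP, hMp s hs hsP]
  set Gbar : E →L[ℝ] E := -(1 / P) • ∫ s in (0:ℝ)..P, Fm s with hGbar
  have hintF : ∫ s in (0:ℝ)..P, Fm s = -(P • Gbar) := by
    rw [hGbar, smul_smul]; field_simp; simp
  have hGn0 : 0 ≤ s₀ + δ * r := by positivity
  have hGn : ‖Gbar‖ ≤ s₀ + δ * r := by
    rw [hGbar, norm_smul, norm_neg, Real.norm_eq_abs, abs_of_pos (by positivity : (0:ℝ) < 1 / P)]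
    have h := intervalIntegral.norm_integral_le_of_norm_le_const (a := (0:ℝ)) (b := P) (C := s₀ + δ * r) (f := Fm)
      (fun s hs => hFmn s ⟨(uIoc_of_le hP.le ▸ hs).1.le, ((uIoc_of_le hP.le ▸ hs).2).trans hPT⟩)
    rw [sub_zero, abs_of_pos hP] at h
    calc 1 / P * ‖∫ s in (0:ℝ)..P, Fm s‖ ≤ 1 / P * ((s₀ + δ * r) * P) := mul_le_mul_of_nonneg_left h (by positivity)
      _ = s₀ + δ * r := by field_simp
  -- coercivity of `Ḡ`
  have hcoer : ∀ v : E, (a₀ - δ * r) * ‖v‖ ^ 2 ≤ ⟪Gbar v, v⟫_ℝ := by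
    intro v
    have hiF : IntervalIntegrable Fm volume 0 P := hFmi 0 P le_rfl hP.le hPT
    have e1 : Gbar v = -(1 / P) • ∫ s in (0:ℝ)..P, Fm s v := by
      rw [hGbar, FunLike.coe_smul, Pi.smul_apply, ContinuousLinearMap.intervalIntegral_apply hiF]
    have hiFv : IntervalIntegrable (fun s => Fm s v) volume 0 P :=
      ((hFmc.mono (Icc_subset_Icc le_rfl hPT)).clm_apply continuousOn_const).intervalIntegrable_of_Icc hP.le
    have e2 : ⟪v, ∫ s in (0:ℝ)..P, Fm s v⟫_ℝ = ∫ s in (0:ℝ)..P, ⟪v, Fm s v⟫_ℝ := by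
      have h := ContinuousLinearMap.intervalIntegral_comp_comm (innerSL ℝ v) hiFv
      simp only [innerSL_apply_apply] at h
      exact h.symm
    have hpt : ∀ s ∈ Icc (0:ℝ) P, ⟪v, Fm s v⟫_ℝ ≤ -(a₀ - δ * r) * ‖v‖ ^ 2 := by
      intro s hs
      have hsT : s ∈ Icc 0 T := ⟨hs.1, hs.2.trans hPT⟩
      have h1 : ⟪v, A₁₁ s v⟫_ℝ ≤ -a₀ * ‖v‖ ^ 2 := by rw [real_inner_comm]; exact ha₀ s hsT v
      have h2 : ⟪v, A₁₂ s (M s v)⟫_ℝ ≤ δ * r * ‖v‖ ^ 2 := by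
        calc ⟪v, A₁₂ s (M s v)⟫_ℝ ≤ ‖v‖ * ‖A₁₂ s (M s v)‖ := real_inner_le_norm _ _
          _ ≤ ‖v‖ * (δ * (r * ‖v‖)) := by
              refine mul_le_mul_of_nonneg_left ?_ (norm_nonneg _)
              calc ‖A₁₂ s (M s v)‖ ≤ ‖A₁₂ s‖ * ‖M s v‖ := (A₁₂ s).le_opNorm _
                _ ≤ δ * (r * ‖v‖) := mul_le_mul (h₁₂ s hsT) (((M s).le_opNorm v).trans
                    (mul_le_mul_of_nonneg_right (hMb s hsT) (norm_nonneg _))) (norm_nonneg _) hδ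
          _ = δ * r * ‖v‖ ^ 2 := by ring
      have e : ⟪v, Fm s v⟫_ℝ = ⟪v, A₁₁ s v⟫_ℝ + ⟪v, A₁₂ s (M s v)⟫_ℝ := by
        simp only [hFm, FunLike.coe_add, Pi.add_apply, ContinuousLinearMap.comp_apply, inner_add_right]
      rw [e]; linarith
    have hci : ContinuousOn (fun s => ⟪v, Fm s v⟫_ℝ) (Icc 0 P) :=
      continuousOn_const.inner ((hFmc.mono (Icc_subset_Icc le_rfl hPT)).clm_apply continuousOn_const)
    have hint : ∫ s in (0:ℝ)..P, ⟪v, Fm s v⟫_ℝ ≤ ∫ _ in (0:ℝ)..P, -(a₀ - δ * r) * ‖v‖ ^ 2 :=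
      intervalIntegral.integral_mono_on hP.le (hci.intervalIntegrable_of_Icc hP.le) intervalIntegrable_const hpt
    rw [intervalIntegral.integral_const, sub_zero, smul_eq_mul] at hint
    rw [real_inner_comm, e1, inner_smul_right, e2]
    have hP' : 0 < 1 / P := by positivity
    have h3 : (1 / P) * ∫ s in (0:ℝ)..P, ⟪v, Fm s v⟫_ℝ ≤ (1 / P) * (P * (-(a₀ - δ * r) * ‖v‖ ^ 2)) :=
      mul_le_mul_of_nonneg_left hint hP'.le
    rw [← mul_assoc, one_div_mul_cancel hP.ne', one_mul] at h3
    linarith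
  -- time clamp and the perturbation `g`
  set c : ℝ → ℝ := fun s => max 0 (min s T) with hc
  have hc_mem : ∀ s, c s ∈ Icc 0 T := fun s => ⟨le_max_left _ _, max_le hT (min_le_right _ _)⟩
  have hc_id : ∀ s ∈ Icc 0 T, c s = s := fun s hs => by
    show max 0 (min s T) = s
    rw [min_eq_left hs.2, max_eq_right hs.1]
  have hc_cont : Continuous c := continuous_const.max (continuous_id.min continuous_const)
  set g : ℝ → E →L[ℝ] E := fun s => -(A₁₁ (c s) + (A₁₂ (c s)).comp (L (c s))) - Gbar with hg
  have hgc : Continuous g := by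
    have h1 : Continuous fun s => A₁₁ (c s) := hc₁₁.comp_continuous hc_cont hc_mem
    have h2 : Continuous fun s => A₁₂ (c s) := hc₁₂.comp_continuous hc_cont hc_mem
    have h3 : Continuous fun s => L (c s) := hLc.comp_continuous hc_cont hc_mem
    exact (h1.add (h2.clm_comp h3)).neg.sub continuous_const
  have hLg : ∀ s ∈ Icc 0 t, ‖g s‖ ≤ 2 * (s₀ + δ * r) := by
    intro s _
    have hcs := hc_mem s
    have h1 : ‖A₁₁ (c s) + (A₁₂ (c s)).comp (L (c s))‖ ≤ s₀ + δ * r :=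
      (norm_add_le _ _).trans (add_le_add (h₁₁ _ hcs) ((ContinuousLinearMap.opNorm_comp_le _ _).trans
        (mul_le_mul (h₁₂ _ hcs) (hLb _ hcs) (norm_nonneg _) hδ)))
    calc ‖g s‖ ≤ ‖-(A₁₁ (c s) + (A₁₂ (c s)).comp (L (c s)))‖ + ‖Gbar‖ := norm_sub_le _ _
      _ ≤ (s₀ + δ * r) + (s₀ + δ * r) := by rw [norm_neg]; exact add_le_add h1 hGn
      _ = 2 * (s₀ + δ * r) := by ring
  -- the reduced equation in averaging form
  have hxd' : ∀ s ∈ Icc 0 t, HasDerivAt x (-(Gbar (x s) + g s (x s))) s := by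
    intro s hs
    have hsI : s ∈ Ico 0 T := ⟨hs.1, lt_of_le_of_lt hs.2 ht.2⟩
    refine (hxd s hsI).congr_deriv ?_
    simp only [hg, hc_id s (Ico_subset_Icc_self hsI), FunLike.coe_sub, FunLike.coe_add, FunLike.coe_neg, Pi.sub_apply, Pi.add_apply,
      Pi.neg_apply, ContinuousLinearMap.comp_apply]
    abel
  -- the a priori bound `‖x s‖ ≤ ‖x 0‖` (slow energy is non-increasing)
  have hxE : ∀ s ∈ Icc 0 T, ‖x s‖ ^ 2 ≤ ‖x 0‖ ^ 2 := by
    have hcont : ContinuousOn (fun s => ‖x s‖ ^ 2) (Icc 0 T) := (hxc.norm).pow 2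
    have hder : ∀ s ∈ Ico 0 T, HasDerivWithinAt (fun s => ‖x s‖ ^ 2) (2 * ⟪x s, (A₁₁ s + (A₁₂ s).comp (L s)) (x s)⟫_ℝ) (Ici s) s :=
      fun s hs => (hxd s hs).norm_sq.hasDerivWithinAt
    have key := image_le_of_deriv_right_le_deriv_boundary hcont hder (B := fun _ => ‖x 0‖ ^ 2) (B' := fun _ => (0:ℝ)) le_rfl
      continuousOn_const (fun s _ => (hasDerivAt_const s (‖x 0‖ ^ 2)).hasDerivWithinAt) ?_
    · exact fun s hs => key hs
    · intro s hs
      have hsI := Ico_subset_Icc_self hs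
      have h1 : ⟪x s, A₁₁ s (x s)⟫_ℝ ≤ -a₀ * ‖x s‖ ^ 2 := by rw [real_inner_comm]; exact ha₀ s hsI (x s)
      have h2 : ⟪x s, A₁₂ s (L s (x s))⟫_ℝ ≤ δ * r * ‖x s‖ ^ 2 := by
        calc ⟪x s, A₁₂ s (L s (x s))⟫_ℝ ≤ ‖x s‖ * ‖A₁₂ s (L s (x s))‖ := real_inner_le_norm _ _
          _ ≤ ‖x s‖ * (δ * (r * ‖x s‖)) := by
              refine mul_le_mul_of_nonneg_left ?_ (norm_nonneg _)
              calc ‖A₁₂ s (L s (x s))‖ ≤ ‖A₁₂ s‖ * ‖L s (x s)‖ := (A₁₂ s).le_opNorm _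
                _ ≤ δ * (r * ‖x s‖) := mul_le_mul (h₁₂ s hsI) (((L s).le_opNorm _).trans
                    (mul_le_mul_of_nonneg_right (hLb s hsI) (norm_nonneg _))) (norm_nonneg _) hδ
          _ = δ * r * ‖x s‖ ^ 2 := by ring
      have e : ⟪x s, (A₁₁ s + (A₁₂ s).comp (L s)) (x s)⟫_ℝ = ⟪x s, A₁₁ s (x s)⟫_ℝ + ⟪x s, A₁₂ s (L s (x s))⟫_ℝ := by
        simp only [FunLike.coe_add, Pi.add_apply, ContinuousLinearMap.comp_apply, inner_add_right]
      show 2 * ⟪x s, (A₁₁ s + (A₁₂ s).comp (L s)) (x s)⟫_ℝ ≤ 0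
      rw [e]
      have : 0 ≤ ‖x s‖ ^ 2 := sq_nonneg _
      nlinarith
  have hxM : ∀ s ∈ Icc 0 t, ‖x s‖ ≤ ‖x 0‖ := fun s hs =>
    (pow_le_pow_iff_left₀ (norm_nonneg _) (norm_nonneg _) two_ne_zero).mp (hxE s ⟨hs.1, hs.2.trans ht.2.le⟩)
  -- window means: the periodic part averages to `−PḠ` exactly, the transient `A₁₂(L − M)` to at most `δr/κ`
  have hmean : ∀ n : ℕ, ((n:ℝ) + 1) * P ≤ t →
      ‖∫ s in ((n:ℝ) * P)..(((n:ℝ) + 1) * P), g s‖ ≤ (δ * r / (κ * P)) * P := by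
    intro n hn
    have hn0 : 0 ≤ (n:ℝ) * P := by positivity
    have hnle : (n:ℝ) * P ≤ ((n:ℝ) + 1) * P := by nlinarith
    have hn1T : ((n:ℝ) + 1) * P ≤ T := hn.trans ht.2.le
    have hwin : ∀ s ∈ uIcc ((n:ℝ) * P) (((n:ℝ) + 1) * P), s ∈ Icc 0 T := fun s hs => by
      rw [uIcc_of_le hnle] at hs; exact ⟨hn0.trans hs.1, hs.2.trans hn1T⟩
    -- split `g = (−Fm − Ḡ) − A₁₂ ∘ (L − M)` on the window
    have hsplit : EqOn g (fun s => (-(Fm s) - Gbar) - (A₁₂ s).comp (L s - M s)) (uIcc ((n:ℝ) * P) (((n:ℝ) + 1) * P)) := by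
      intro s hs
      have hsT := hwin s hs
      simp only [hg, hFm, hc_id s hsT, ContinuousLinearMap.comp_sub]
      abel
    rw [intervalIntegral.integral_congr hsplit]
    have hiF : IntervalIntegrable Fm volume ((n:ℝ) * P) (((n:ℝ) + 1) * P) := hFmi _ _ hn0 hnle hn1T
    have hiFn : IntervalIntegrable (fun s => -(Fm s)) volume ((n:ℝ) * P) (((n:ℝ) + 1) * P) := hiF.neg
    have hi1 : IntervalIntegrable (fun s => -(Fm s) - Gbar) volume ((n:ℝ) * P) (((n:ℝ) + 1) * P) :=
      hiFn.sub intervalIntegrable_const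
    have hcD : ContinuousOn (fun s => (A₁₂ s).comp (L s - M s)) (Icc 0 T) := hc₁₂.clm_comp (hLc.sub hMc)
    have hi2 : IntervalIntegrable (fun s => (A₁₂ s).comp (L s - M s)) volume ((n:ℝ) * P) (((n:ℝ) + 1) * P) :=
      (hcD.mono (Icc_subset_Icc hn0 hn1T)).intervalIntegrable_of_Icc hnle
    rw [intervalIntegral.integral_sub hi1 hi2, intervalIntegral.integral_sub hiFn intervalIntegrable_const,
      intervalIntegral.integral_neg, intervalIntegral.integral_const]
    -- periodicity: `∫_{nP}^{(n+1)P} Fm = ∫₀^P Fm = −P Ḡ`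
    have hper : ∫ s in ((n:ℝ) * P)..(((n:ℝ) + 1) * P), Fm s = ∫ s in (0:ℝ)..P, Fm s := by
      have h := intervalIntegral.integral_comp_add_right (fun s => Fm s) ((n:ℝ) * P) (a := 0) (b := P)
      rw [zero_add, show P + (n:ℝ) * P = ((n:ℝ) + 1) * P by ring] at h
      rw [← h]
      refine intervalIntegral.integral_congr fun s hs => ?_
      rw [uIcc_of_le hP.le] at hs
      exact periodic_shift_nat hP.le hFmp n s hs.1 (by nlinarith [hs.2])
    rw [hper, hintF]
    have e0 : -(-(P • Gbar)) - (((n:ℝ) + 1) * P - (n:ℝ) * P) • Gbar = 0 := by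
      rw [show ((n:ℝ) + 1) * P - (n:ℝ) * P = P by ring]; simp
    rw [e0, zero_sub, norm_neg]
    -- the transient
    have hbd : ∀ᵐ s ∂volume, s ∈ Ioc ((n:ℝ) * P) (((n:ℝ) + 1) * P) → ‖(A₁₂ s).comp (L s - M s)‖ ≤ δ * r * Real.exp (-(κ * s)) := by
      refine Filter.Eventually.of_forall fun s hs => ?_
      have hsT : s ∈ Icc 0 T := ⟨hn0.trans hs.1.le, hs.2.trans hn1T⟩
      calc ‖(A₁₂ s).comp (L s - M s)‖ ≤ ‖A₁₂ s‖ * ‖L s - M s‖ := ContinuousLinearMap.opNorm_comp_le _ _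
        _ ≤ δ * (r * Real.exp (-(κ * s))) := mul_le_mul (h₁₂ s hsT) (hLM s hsT) (norm_nonneg _) hδ
        _ = δ * r * Real.exp (-(κ * s)) := by ring
    have hie : IntervalIntegrable (fun s => δ * r * Real.exp (-(κ * s))) volume ((n:ℝ) * P) (((n:ℝ) + 1) * P) :=
      (continuous_const.mul (Real.continuous_exp.comp (continuous_const.mul continuous_id).neg)).intervalIntegrable _ _
    calc ‖∫ s in ((n:ℝ) * P)..(((n:ℝ) + 1) * P), (A₁₂ s).comp (L s - M s)‖
        ≤ ∫ s in ((n:ℝ) * P)..(((n:ℝ) + 1) * P), δ * r * Real.exp (-(κ * s)) := intervalIntegral.norm_integral_le_of_norm_le hnle hbd hie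
      _ = δ * r * ∫ s in ((n:ℝ) * P)..(((n:ℝ) + 1) * P), Real.exp (-(κ * s)) := by rw [intervalIntegral.integral_const_mul]
      _ ≤ δ * r * (1 / κ) := mul_le_mul_of_nonneg_left (integral_exp_neg_mul_le hκpos hn0) (by positivity)
      _ = δ * r / (κ * P) * P := by field_simp
  -- Besjes / Sanders–Verhulst–Murdock averaging (ad-lit `LinearPeriodicAveraging`)
  haveI : CompleteSpace E := FiniteDimensional.complete ℝ E
  have hη : 0 ≤ δ * r / (κ * P) := by positivity
  have key := Literature.Analysis.ODE.PeriodicAveraging.norm_sub_exp_apply_le Gbar hgc x hrlo hP hη ht.1 hcoer hGn hLg hmean hxd' hxM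
  simpa only [hr, hκ] using key

end Tracking

end SlowGraph

end Summit.AnomalousDissipation.AnomalousDissipation.Theorems.SolenoidalFractalHomogenisation.LagrangianStep

end
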